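import Summits.Ventures.PercRepro.Night2ExcessMass

/-!
# PercRepro — the loss mass of a target counts only its covering BASES (night-2, gen 21)

`pi2Mass_le_excess` (gen 20) charged every `ρ`-subset `T` of `S ∖ K` with the per-basis bound `E`, i.e. the crude count
`C(|S ∖ K|, ρ)`.  The loss pairs `(B, z)` targeting `S` map to `T = {z} ∪ (B ∖ K)` with `K ∪ T = B ∪ {z}` INDEPENDENT
(`indep_of_mem_shadowAt_card`: a lossy member is a hyperplane-basis member and `z ∉ cl B`), so only the covering
BASES count:

* **`pi2Mass_le_excess_indep`**: `pi2Mass S ≤ #{T ∈ powersetCard ρ (S ∖ K) : K ∪ T independent} · E/(2^{n−ρ} − 1)`;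
* **`pi2Mass_le_excess_count`**: the same with any function `cnt` dominating that number of bases on every
  target (`cnt |S ∖ K|`);
* **`localShadowHall_excess_of_count`**: the assembly of `localShadowHall_excess_of_sum'` with the per-target bound
  `u(s) = cnt (s − k) · E/(2^{n−ρ} − 1)` — (LI_G) as soon as
  `Σ_{j=1}^{n−ρ} C(n−ρ, j) · c_j / (cnt (j + ρ) · E) ≥ 2^{n−ρ} − 1` … stated directly through `lossIncome_ge_of_bounds`:
  `Σ_j C(n−ρ, j) · v(q+1+j) / u(q+1+j) ≥ 2^{n−ρ} − 1`.
On the cone of `NIGHT-2-g20.md` §2 the bases inside the worst target number 32 / 80 / 144 at `|S| = 9 / 10 / 11` against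
`C(s, 6) = 84 / 210 / 462` (`mining/night-2/g21/hypsum21.py`) — the count is the larger of the two crude factors.
-/

namespace PercRepro.Shadow

open Finset PerFlat ThmH

variable {α : Type*} [DecidableEq α] {M : Matroid α} [M.Finite]

open scoped Classical in
/-- The covering bases of a target `S`: the `ρ`-subsets `T` of `S ∖ K` with `K ∪ T` independent. -/
noncomputable def coverBases (M : Matroid α) [M.Finite] (G S : Finset α) (ρ : ℕ) : Finset (Finset α) :=
  ((S \ coloops M G).powersetCard ρ).filter (fun T => M.Indep ((coloops M G ∪ T : Finset α) : Set α))

open scoped Classical in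
/-- **The loss mass of a target through its covering BASES**: if the face losses of every covering basis
`K ∪ T` sum to at most `E ≥ 0`, then `pi2Mass S ≤ #coverBases(S) · E/(2^{n−ρ} − 1)`. -/
theorem pi2Mass_le_excess_indep {q d ρ m₁ : ℕ} {G : Finset α} (hG : G ∈ flatsQ M (q + 1)) (hd : (gr M \ G).card = d)
    (hdq : d ≤ q) (hk : kColoops M G + ρ = q + 1)
    (hc : 0 ≤ cPrimeDGP q d ρ (kColoops M G) m₁)
    (hs : ∀ e ∈ gr M, ∀ f ∈ gr M, e ≠ f → rkN M {e, f} = 2) (hl : ∀ e ∈ gr M, M.Indep {e})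
    (hm₁ : ∀ B ∈ thinMembers M q G, ρ ≤ (B \ coloops M G).card → m₁ ≤ (G \ clF M B).card)
    {E : ℚ} (S : Finset α)
    (hTE : ∀ T ∈ coverBases M G S ρ, ∑ w ∈ T, faceLoss M q G (coloops M G ∪ T) w ≤ E) :
    pi2Mass M q G S ≤
      ((coverBases M G S ρ).card : ℚ) * (E / ((2 ^ ((G.card - kColoops M G) - ρ) - 1 : ℕ) : ℚ)) := by
  have hd' : (gr M \ G).card ≤ q := by omega
  rw [pi2Mass_eq_sum_lossPairsAt]
  set r := (G.card - kColoops M G) - ρ with hr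
  set D : ℚ := ((2 ^ r - 1 : ℕ) : ℚ) with hD
  have hD0 : 0 ≤ D := by rw [hD]; positivity
  -- the pairs with zero weight contribute nothing
  set F := (lossPairsAt M q G S).filter (fun p => rhoL M q G p.1 p.2 ≠ 0) with hF
  have hsplit : ∑ p ∈ lossPairsAt M q G S, rhoL M q G p.1 p.2 = ∑ p ∈ F, rhoL M q G p.1 p.2 := by
    rw [hF, Finset.sum_filter]
    apply Finset.sum_congr rfl
    intro p _
    split_ifs with h
    · rfl
    · push Not at h; rw [h]
  rw [hsplit]
  -- the grouping map and the face-loss weight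
  set g : (Σ _T : Finset α, α) → ℚ := fun x => faceLoss M q G (coloops M G ∪ x.1) x.2 / D with hg
  set φ : Finset α × α → (Σ _T : Finset α, α) := fun p => ⟨insert p.2 (p.1 \ coloops M G), p.2⟩ with hφ
  -- facts about the members of F
  have hmem : ∀ p ∈ F, p.1 ∈ thinMembers M q G ∧ p.2 ∈ G \ clF M p.1 ∧ S ∈ tgtSets M q G p.1 p.2 ∧
      (p.1 \ coloops M G).card + 1 = ρ := by
    intro p hp
    rw [hF, Finset.mem_filter] at hp
    obtain ⟨hp, hρ'⟩ := hp
    unfold lossPairsAt at hp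
    rw [Finset.mem_filter, Finset.mem_image] at hp
    obtain ⟨⟨x, hx, rfl⟩, hpS⟩ := hp
    rw [Finset.mem_sigma] at hx
    obtain ⟨hB, hz⟩ := hx
    exact ⟨hB, hz, hpS, card_sdiff_add_one_eq_of_rhoL_ne_zero_dgenP hG hd hdq hk hc hs hl hm₁ hB hz hρ'⟩
  have hval : ∀ p ∈ F, rhoL M q G p.1 p.2 = g (φ p) := by
    intro p hp
    obtain ⟨hB, hz, -, h2⟩ := hmem p hp
    have hB' : p.1 ∈ membersIn M (Uq M (q + 2) q) G := (mem_thinMembers.1 hB).1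
    have hBU : p.1 ∈ Uq M (q + 2) q := (mem_membersIn.1 hB').1
    have hzB : p.2 ∉ p.1 := notMem_of_notMem_clF hBU (Finset.mem_sdiff.1 hz).2
    have hK : coloops M G ⊆ p.1 := coloops_subset_of_mem_thinMembers hG hd' hB
    have hQ : coloops M G ∪ insert p.2 (p.1 \ coloops M G) = insert p.2 p.1 := by
      ext x
      simp only [Finset.mem_union, Finset.mem_insert, Finset.mem_sdiff]
      constructor
      · rintro (h | h | ⟨h, -⟩)
        · exact Or.inr (hK h)
        · exact Or.inl h
        · exact Or.inr h
      · rintro (h | h)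
        · exact Or.inr (Or.inl h)
        · by_cases hx : x ∈ coloops M G
          · exact Or.inl hx
          · exact Or.inr (Or.inr ⟨h, hx⟩)
    simp only [hg, hφ]
    rw [hQ]
    unfold rhoL faceLoss
    rw [Finset.erase_insert hzB, if_pos ⟨hB, hz⟩, card_tgtSets hG hB' hz,
      card_sdiff_insert_eq_dqm1 hG hd' hB h2 hz, ← hr]
  have hinj : Set.InjOn φ (F : Set (Finset α × α)) := by
    intro p hp p' hp' heq
    obtain ⟨hB, hz, -, -⟩ := hmem p hp
    obtain ⟨hB', hz', -, -⟩ := hmem p' hp'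
    simp only [hφ, Sigma.mk.injEq] at heq
    obtain ⟨hT, hzz⟩ := heq
    have hzz' : p.2 = p'.2 := eq_of_heq hzz
    have hBU : p.1 ∈ Uq M (q + 2) q := (mem_membersIn.1 (mem_thinMembers.1 hB).1).1
    have hBU' : p'.1 ∈ Uq M (q + 2) q := (mem_membersIn.1 (mem_thinMembers.1 hB').1).1
    have hBB := lossPairs_inj hG hd' hB hB' hT hzz'
      (notMem_of_notMem_clF hBU (Finset.mem_sdiff.1 hz).2)
      (notMem_of_notMem_clF hBU' (Finset.mem_sdiff.1 hz').2)
    exact Prod.ext hBB hzz'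
  have himg : Finset.image φ F ⊆ (coverBases M G S ρ).sigma (fun T => T) := by
    intro x hx
    rw [Finset.mem_image] at hx
    obtain ⟨p, hp, rfl⟩ := hx
    obtain ⟨hB, hz, hpS, h2⟩ := hmem p hp
    have hB' : p.1 ∈ membersIn M (Uq M (q + 2) q) G := (mem_thinMembers.1 hB).1
    have hBU : p.1 ∈ Uq M (q + 2) q := (mem_membersIn.1 hB').1
    have hzB : p.2 ∉ p.1 := notMem_of_notMem_clF hBU (Finset.mem_sdiff.1 hz).2
    have hzK : p.2 ∉ p.1 \ coloops M G := fun hh => hzB (Finset.mem_sdiff.1 hh).1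
    have hsub : insert p.2 p.1 ⊆ S := (mem_tgtSets.1 hpS).2.1
    have hK : coloops M G ⊆ p.1 := coloops_subset_of_mem_thinMembers hG hd' hB
    have hQ : coloops M G ∪ insert p.2 (p.1 \ coloops M G) = insert p.2 p.1 := by
      ext y
      simp only [Finset.mem_union, Finset.mem_insert, Finset.mem_sdiff]
      constructor
      · rintro (h | h | ⟨h, -⟩)
        · exact Or.inr (hK h)
        · exact Or.inl h
        · exact Or.inr h
      · rintro (h | h)
        · exact Or.inr (Or.inl h)
        · by_cases hy : y ∈ coloops M G
          · exact Or.inl hy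
          · exact Or.inr (Or.inr ⟨h, hy⟩)
    have hcard : (insert p.2 p.1 \ coloops M G).card = ρ := by
      have : insert p.2 p.1 \ coloops M G = insert p.2 (p.1 \ coloops M G) := by
        ext y
        simp only [Finset.mem_sdiff, Finset.mem_insert]
        constructor
        · rintro ⟨h | h, hy⟩
          · exact Or.inl h
          · exact Or.inr ⟨h, hy⟩
        · rintro (rfl | ⟨h, hy⟩)
          · exact ⟨Or.inl rfl, fun hc => hzB (hK hc)⟩
          · exact ⟨Or.inr h, hy⟩
      rw [this, Finset.card_insert_of_notMem hzK, h2]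
    have hind : M.Indep ((coloops M G ∪ insert p.2 (p.1 \ coloops M G) : Finset α) : Set α) := by
      rw [hQ]
      exact indep_of_mem_shadowAt_card hk (insert_mem_shadowAt_thin hG hB hz) hcard
    rw [Finset.mem_sigma]
    refine ⟨?_, Finset.mem_insert_self _ _⟩
    unfold coverBases
    rw [Finset.mem_filter, Finset.mem_powersetCard]
    refine ⟨⟨?_, ?_⟩, hind⟩
    · intro y hy
      rw [Finset.mem_insert] at hy
      rw [Finset.mem_sdiff]
      rcases hy with rfl | hy
      · refine ⟨hsub (Finset.mem_insert_self _ _), ?_⟩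
        intro hzc
        exact hzB (hK hzc)
      · rw [Finset.mem_sdiff] at hy
        exact ⟨hsub (Finset.mem_insert_of_mem hy.1), hy.2⟩
    · rw [Finset.card_insert_of_notMem hzK, h2]
  have hg0 : ∀ x, 0 ≤ g x := fun x => div_nonneg (faceLoss_nonneg hG hd' _ _) hD0
  calc ∑ p ∈ F, rhoL M q G p.1 p.2 = ∑ p ∈ F, g (φ p) := Finset.sum_congr rfl hval
    _ = ∑ x ∈ Finset.image φ F, g x := (Finset.sum_image hinj).symm
    _ ≤ ∑ x ∈ (coverBases M G S ρ).sigma (fun T => T), g x :=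
        Finset.sum_le_sum_of_subset_of_nonneg himg (fun x _ _ => hg0 x)
    _ = ∑ T ∈ coverBases M G S ρ, (∑ w ∈ T, faceLoss M q G (coloops M G ∪ T) w) / D := by
        rw [Finset.sum_sigma]
        apply Finset.sum_congr rfl
        intro T _
        rw [Finset.sum_div]
    _ ≤ ∑ _T ∈ coverBases M G S ρ, E / D := by
        apply Finset.sum_le_sum
        intro T hT
        exact div_le_div_of_nonneg_right (hTE T hT) hD0
    _ = ((coverBases M G S ρ).card : ℚ) * (E / D) := by
        rw [Finset.sum_const, nsmul_eq_mul]

open scoped Classical in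
/-- `coverBases ⊆ powersetCard ρ (S ∖ K)`, so `#coverBases ≤ C(|S ∖ K|, ρ)`: the refinement is never worse than the
crude count. -/
theorem card_coverBases_le (G S : Finset α) (ρ : ℕ) :
    (coverBases M G S ρ).card ≤ (S \ coloops M G).card.choose ρ := by
  unfold coverBases
  calc (((S \ coloops M G).powersetCard ρ).filter
        (fun T => M.Indep ((coloops M G ∪ T : Finset α) : Set α))).card
      ≤ ((S \ coloops M G).powersetCard ρ).card := Finset.card_filter_le _ _
    _ = (S \ coloops M G).card.choose ρ := Finset.card_powersetCard _ _

/-- The target sum with a count function `cnt` for the covering bases of the targets of size `ρ + j` (off the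
coloops): `Σ_{j=1}^{n−ρ} C(n−ρ, j) · c_j / (cnt (j+ρ) · E)`. -/
noncomputable def countSum (n ρ t : ℕ) (c' E : ℚ) (cnt : ℕ → ℚ) : ℚ :=
  ∑ j ∈ Finset.Icc 1 (n - ρ), ((n - ρ).choose j : ℚ) * (DGenP.cjG n ρ t j c' / (cnt (j + ρ) * E))

open scoped Classical in
/-- **THE ASSEMBLY WITH A COUNT OF THE COVERING BASES**: in the partial-spread regime, if the face losses of every
covering basis sum to at most `E > 0` and every target `S ⊆ G` has at most `cnt |S ∖ K|` covering bases
(`cnt > 0` on `[ρ + 1, n]`), then (LI_G) holds as soon as `countSum n ρ (q − d + 1) c′ E cnt ≥ 1` at `n = |G ∖ K|`.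
With `cnt s = C(s, ρ)` this is `localShadowHall_excess_of_sum'`. -/
theorem localShadowHall_excess_of_count {q d ρ m₁ : ℕ} {G : Finset α} (hG : G ∈ flatsQ M (q + 1))
    (hd : (gr M \ G).card = d) (hdq : d ≤ q) (hk : kColoops M G + ρ = q + 1) (hρ : 3 ≤ ρ)
    (hs : ∀ e ∈ gr M, ∀ f ∈ gr M, e ≠ f → rkN M {e, f} = 2)
    (hl : ∀ e ∈ gr M, M.Indep {e}) (hc : 0 ≤ cPrimeDGP q d ρ (kColoops M G) m₁)
    (hm₁ : ∀ B ∈ thinMembers M q G, ρ ≤ (B \ coloops M G).card → m₁ ≤ (G \ clF M B).card)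
    {E : ℚ} (hE : 0 < E)
    (hTE : ∀ S : Finset α, S ⊆ G → ∀ T ∈ coverBases M G S ρ,
      ∑ w ∈ T, faceLoss M q G (coloops M G ∪ T) w ≤ E)
    {cnt : ℕ → ℚ} (hcpos : ∀ s, ρ + 1 ≤ s → s ≤ G.card - kColoops M G → 0 < cnt s)
    (hcnt : ∀ S : Finset α, S ⊆ G → ((coverBases M G S ρ).card : ℚ) ≤ cnt (S \ coloops M G).card)
    (hsum : 1 ≤ countSum (G.card - kColoops M G) ρ (q - d + 1) (cPrimeDGP q d ρ (kColoops M G) m₁) E cnt) :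
    LocalShadowHall M q G := by
  have hd' : (gr M \ G).card ≤ q := by omega
  have hKG : coloops M G ⊆ G := fun y hy => (mem_coloops.1 hy).1
  apply localShadowHall_of_lossFair hG hd'
  intro B hB z hz
  by_cases hl0 : loss M q G B z = 0
  · rw [hl0]
    exact mul_nonneg (rhoL_nonneg hG hd' B z) (lossIncome_nonneg hG hd' B z)
  have hB' : B ∈ membersIn M (Uq M (q + 2) q) G := (mem_thinMembers.1 hB).1
  have hBU : B ∈ Uq M (q + 2) q := (mem_membersIn.1 hB').1
  have hzB : z ∉ B := notMem_of_notMem_clF hBU (Finset.mem_sdiff.1 hz).2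
  have hK := coloops_subset_of_mem_thinMembers hG hd' hB
  have h2 : (B \ coloops M G).card + 1 = ρ := by
    by_contra hne
    have hge := card_sdiff_coloops_thin_ge hG hd' hk hB
    exact hl0 (loss_eq_zero_of_card_ge_dgenP hG hd hdq hk hc hs hl hm₁ hB (by omega) hz)
  set n := G.card - kColoops M G with hn
  have hr : (G \ insert z B).card = n - ρ := card_sdiff_insert_eq_dqm1 hG hd' hB h2 hz
  have hr1 : 1 ≤ n - ρ := by rw [← hr]; exact one_le_card_sdiff_insert hG hd' hB hz
  have hBcard : B.card = kColoops M G + (B \ coloops M G).card := by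
    rw [kColoops_eq_card_coloops, ← Finset.card_union_of_disjoint Finset.disjoint_sdiff,
      Finset.union_sdiff_of_subset hK]
  have hb' : (insert z B).card = q + 1 := by rw [Finset.card_insert_of_notMem hzB, hBcard]; omega
  have hT : (tgtSets M q G B z).card = 2 ^ (n - ρ) - 1 := by rw [card_tgtSets hG hB' hz, hr]
  have hTpos : (0 : ℚ) < ((2 ^ (n - ρ) - 1 : ℕ) : ℚ) := by
    have : 2 ≤ 2 ^ (n - ρ) := by
      calc 2 = 2 ^ 1 := by norm_num
        _ ≤ 2 ^ (n - ρ) := Nat.pow_le_pow_right (by norm_num) hr1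
    exact_mod_cast (by omega : 0 < 2 ^ (n - ρ) - 1)
  have hGcard : G.card = n + kColoops M G := by
    have : kColoops M G ≤ G.card := by
      rw [kColoops_eq_card_coloops]
      exact Finset.card_le_card hKG
    omega
  set u : ℕ → ℚ := fun s => cnt (s - kColoops M G) * (E / ((2 ^ (n - ρ) - 1 : ℕ) : ℚ)) with hu_def
  set v : ℕ → ℚ := fun s => if s + (q - d + 1) ≤ G.card then cPrimeDGP q d ρ (kColoops M G) m₁ else 1 with hv_def
  have hKS : ∀ S ∈ tgtSets M q G B z, coloops M G ⊆ S :=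
    fun S hS => coloops_subset_of_mem_shadowAt (mem_tgtSets.1 hS).1
  have hSK : ∀ S ∈ tgtSets M q G B z, (S \ coloops M G).card = S.card - kColoops M G := by
    intro S hS
    rw [Finset.card_sdiff_of_subset (hKS S hS), kColoops_eq_card_coloops]
  have hρ1 : ∀ S ∈ tgtSets M q G B z, ρ + 1 ≤ (S \ coloops M G).card := by
    intro S hS
    obtain ⟨-, hBS, hcard⟩ := mem_tgtSets.1 hS
    have hBS' : B ⊆ S := (Finset.subset_insert z B).trans hBS
    have hsub : (S \ B) ∪ (B \ coloops M G) ⊆ S \ coloops M G := by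
      intro x hx
      rw [Finset.mem_union, Finset.mem_sdiff, Finset.mem_sdiff] at hx
      rw [Finset.mem_sdiff]
      rcases hx with ⟨hxS, hxB⟩ | ⟨hxB, hxK⟩
      · exact ⟨hxS, fun h => hxB (hK h)⟩
      · exact ⟨hBS' hxB, hxK⟩
    have hdisj : Disjoint (S \ B) (B \ coloops M G) := by
      rw [Finset.disjoint_left]; intro x hx hx'
      exact (Finset.mem_sdiff.1 hx).2 (Finset.mem_sdiff.1 hx').1
    have := Finset.card_le_card hsub
    rw [Finset.card_union_of_disjoint hdisj] at this
    omega
  have hρ0 : (0 : ℚ) < (ρ : ℚ) := by exact_mod_cast (by omega : 0 < ρ)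
  have hu : ∀ S ∈ tgtSets M q G B z, pi2Mass M q G S ≤ u S.card := by
    intro S hS
    have hSG : S ⊆ G := subset_G_of_mem_shadowAt (mem_tgtSets.1 hS).1
    have hmass := pi2Mass_le_excess_indep hG hd hdq hk hc hs hl hm₁ S (hTE S hSG)
    have hcntS := hcnt S hSG
    rw [hSK S hS] at hcntS
    have hED : 0 ≤ E / ((2 ^ (n - ρ) - 1 : ℕ) : ℚ) := div_nonneg hE.le hTpos.le
    simp only [hu_def]
    calc pi2Mass M q G S ≤ ((coverBases M G S ρ).card : ℚ) * (E / ((2 ^ (n - ρ) - 1 : ℕ) : ℚ)) := hmass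
      _ ≤ cnt (S.card - kColoops M G) * (E / ((2 ^ (n - ρ) - 1 : ℕ) : ℚ)) :=
          mul_le_mul_of_nonneg_right hcntS hED
  have hv : ∀ S ∈ tgtSets M q G B z, v S.card ≤ cap2 M q G S := by
    intro S hS
    have hS' := (mem_tgtSets.1 hS).1
    have hSG : S ⊆ G := subset_G_of_mem_shadowAt hS'
    simp only [hv_def]
    split_ifs with hle
    · exact cap2_ge_cPrimeDGP hG hd hdq hk hs hl hm₁ hS' (hρ1 S hS)
    · push Not at hle
      have h1 : (G \ S).card ≤ q - d := by
        rw [Finset.card_sdiff_of_subset hSG]; omega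
      exact (cap2_eq_one_of_card_le hG (by rw [hd]; omega)).ge
  have hv0 : ∀ S ∈ tgtSets M q G B z, 0 ≤ v S.card := by
    intro S _
    simp only [hv_def]
    split_ifs
    · exact hc
    · exact zero_le_one
  have hinc := lossIncome_ge_of_bounds hG hd' hB hz hl0 u v hu hv hv0
  rw [hr, hb'] at hinc
  have hsum' : ∑ j ∈ Finset.Icc 1 (n - ρ), ((n - ρ).choose j : ℚ) * (v (q + 1 + j) / u (q + 1 + j)) =
      ((2 ^ (n - ρ) - 1 : ℕ) : ℚ) * countSum n ρ (q - d + 1) (cPrimeDGP q d ρ (kColoops M G) m₁) E cnt := by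
    unfold countSum
    rw [Finset.mul_sum]
    apply Finset.sum_congr rfl
    intro j hj
    rw [Finset.mem_Icc] at hj
    have hv' : v (q + 1 + j) = DGenP.cjG n ρ (q - d + 1) j (cPrimeDGP q d ρ (kColoops M G) m₁) := by
      simp only [hv_def, DGenP.cjG]
      have hiff : q + 1 + j + (q - d + 1) ≤ G.card ↔ j + ρ + (q - d + 1) ≤ n := by omega
      by_cases hcj : j + ρ + (q - d + 1) ≤ n
      · rw [if_pos (hiff.2 hcj), if_pos hcj]
      · rw [if_neg (fun h => hcj (hiff.1 h)), if_neg hcj]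
    have hu' : u (q + 1 + j) = cnt (j + ρ) * (E / ((2 ^ (n - ρ) - 1 : ℕ) : ℚ)) := by
      simp only [hu_def]
      rw [show q + 1 + j - kColoops M G = j + ρ by omega]
    rw [hv', hu']
    have hjρ : (0 : ℚ) < cnt (j + ρ) := hcpos (j + ρ) (by omega) (by omega)
    field_simp
  rw [hsum'] at hinc
  unfold rhoL
  rw [hT]
  have hl' : 0 < loss M q G B z := lt_of_le_of_ne (loss_nonneg' hG hd' B z) (Ne.symm hl0)
  calc loss M q G B z = loss M q G B z / ((2 ^ (n - ρ) - 1 : ℕ) : ℚ) * ((2 ^ (n - ρ) - 1 : ℕ) : ℚ) := by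
        field_simp
    _ ≤ loss M q G B z / ((2 ^ (n - ρ) - 1 : ℕ) : ℚ) *
          (((2 ^ (n - ρ) - 1 : ℕ) : ℚ) * countSum n ρ (q - d + 1) (cPrimeDGP q d ρ (kColoops M G) m₁) E cnt) := by
        apply mul_le_mul_of_nonneg_left _ (div_nonneg hl'.le hTpos.le)
        nlinarith [hsum, hTpos]
    _ ≤ loss M q G B z / ((2 ^ (n - ρ) - 1 : ℕ) : ℚ) * lossIncome M q G B z :=
        mul_le_mul_of_nonneg_left hinc (div_nonneg hl'.le hTpos.le)

end PercRepro.Shadow
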